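import Literature.NumberTheory.LFunctions.VerjovskyDiscreteMeasures
import Literature.NumberTheory.LFunctions.HorocycleZeroMode
import Literature.NumberTheory.LFunctions.RieszCriterionProofs
import Literature.Analysis.Quadrature.LatticeWindowRiemannSum
import HarnessLib

/-!
RH-FREE (an unconditional asymptotic of Verjovsky's discrete measures; nothing here bears on the
truth of RH). # Verjovsky 1994, Theorem A — PROOF of the named fact `Verjovsky1994_thmA`

`Literature.NumberTheory.LFunctions.Verjovsky1994_thmA_holds : Verjovsky1994_thmA`: for every
`f ∈ C_c¹(ℝ₊ˣ)`, `m_y(f) = m₀(f) + O(y^{1/2} log y)` as `y → 0⁺`, where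
`m_y(f) = Σ_{n ≥ 1} y φ(n) f(n√y)` and `m₀(f) = (6/π²) ∫₀^∞ u f(u) du`
(`Literature/NumberTheory/LFunctions/VerjovskyDiscreteMeasures.lean`).

## The printed proof and the road taken here

Verjovsky [Verjovsky1994, Thm A p. 597, proof §2] (and Estala-Arias [arXiv:1908.03658, §4.1]) derive
Theorem A from Mertens' theorem `Σ_{n ≤ x} φ(n) = (3/π²) x² + O(x log x)` by partial summation.
Mertens' theorem itself is the Möbius inversion `φ(c)/c = Σ_{d ∣ c} μ(d)/d` followed by the
harmonic-sum estimate, and the tree already has that inversion packaged for smooth sums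
(`Literature.NumberTheory.LFunctions.HorocycleZeroMode.sum_totient_div_mul_eq`, used for the zero
Fourier mode of closed horocycles — the same sum). So we run the printed argument one level down,
directly on the smooth sum, which avoids stating Mertens' theorem separately:

1. With `l = √y` and `k(u) = u f(u)` one has `y φ(c) f(c√y) = l · (φ(c)/c) · k(l c)`, so
   `m_y(f) = l Σ_{c ≥ 1} (φ(c)/c) k(l c)` (a finite sum, `verjovskyMeasure_eq_mul_sum`).
2. `Σ_c (φ(c)/c) k(l c) = Σ_d (μ(d)/d) Σ_{m ≥ 1} k(l d m)` (tree, Möbius inversion).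
3. Each row is a Riemann sum of the `C¹` function `k` with step `a = l d`:
   `|a Σ_{m ≥ 1} k(a m) − ∫₀^∞ k| ≤ a (3 sup|k| + ∫|k'|)` — the tree's Euler-summation inequality
   `Literature.Analysis.Quadrature.norm_smul_sum_range_sub_integral_le` [Apostol1976, Thm 3.1]
   (`norm_mul_sum_range_sub_integral_le`). (The horocycle file uses the trapezoidal rule, which
   needs `C²`; Theorem A is stated for `C¹`, where one loses the logarithm below.)
4. Summing `μ(d)/d · (error ≤ C)` over `d ≤ R/l` costs `C Σ_{d ≤ R/l} 1/d ≤ C (1 + log(R/l))`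
   (Mathlib `harmonic_le_one_add_log`); completing `Σ_{d ≤ D} μ(d)/d²` to the full series costs
   `Σ_{d > D} d⁻² ≤ 2/(D+1)` (tree `norm_tsum_moebius_div_sq_sub_le`): `sum_totient_smooth_C1_bound`.
5. `Σ_d μ(d)/d² = 1/ζ(2) = 6/π²` (tree `hasSum_moebius_term_inv_riemannZeta`, Mathlib
   `riemannZeta_two`), so the main term `l · (Σ_d μ(d)/d²)(∫k)/l` is exactly `m₀(f)`
   (`verjovskyMean_eq`), and `l (1 + log(R/l)) ≪ y^{1/2} |log y|` for `0 < y < e⁻¹`.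

## References

* A. Verjovsky, *Discrete measures and the Riemann hypothesis*, Kodai Math. J. 17 (1994) 596–608,
  Theorem A p. 597 [Verjovsky1994].
* T. M. Apostol, *Introduction to Analytic Number Theory*, Springer 1976, Thm 3.1 p. 54 (Euler's
  summation formula) [Apostol1976].

## Mathlib / tree search

Tree: `HorocycleZeroMode.sum_totient_div_mul_eq`, `HorocycleZeroMode.sum_Ioc_zero_eq_sum_range`,
`HorocycleZeroMode.norm_tsum_moebius_div_sq_sub_le`, `HorocycleZeroMode.summable_moebius_div_sq`,
`HorocycleZeroMode.zeroMode_bound` (the `C²` version with `O(1)` error — not applicable to `C¹`),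
`Literature.Analysis.Quadrature.norm_smul_sum_range_sub_integral_le`,
`hasSum_moebius_term_inv_riemannZeta`, `verjovskyMeasure_summable`. Mathlib: `harmonic_eq_sum_Icc`,
`harmonic_le_one_add_log`, `riemannZeta_two`, `intervalIntegral.integral_interval_add_Ioi`,
`Continuous.bounded_above_of_compact_support`. No Mertens totient asymptotic in the tree
(`rg 'sum_totient'` finds only exact identities).
-/

noncomputable section

open Real MeasureTheory Set Filter Finset intervalIntegral Asymptotics Topology

open scoped ArithmeticFunction.Moebius

namespace Literature.NumberTheory.LFunctions

namespace VerjovskyTheoremA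

/-! ### One row: a Riemann sum of a `C¹` function -/

/-- Riemann sums of a compactly supported `C¹` function with step `a`: if `k = 0` on `[R, ∞)`,
`‖k‖ ≤ M₀` and `∫₀^T ‖k'‖ ≤ K₁` for all `T ≥ 0`, then for every `M` with `R ≤ a (M+1)`
`‖a Σ_{i < M} k(a (i+1)) − ∫₀^R k‖ ≤ a (3 M₀ + K₁)` (Euler's summation inequality on `[0, a(M+1)]`
with nodes `a, 2a, …, a(M+1)`, the last node carrying `k = 0`). [cite: Apostol1976, Thm 3.1 p. 54] -/
theorem norm_mul_sum_range_sub_integral_le {k : ℝ → ℂ} (hk : ContDiff ℝ 1 k) {R M₀ K₁ : ℝ}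
    (hkR : ∀ s, R ≤ s → k s = 0) (hM₀ : ∀ s, ‖k s‖ ≤ M₀)
    (hK₁ : ∀ T, 0 ≤ T → ∫ s in (0 : ℝ)..T, ‖deriv k s‖ ≤ K₁)
    {a : ℝ} (ha : 0 < a) {M : ℕ} (hM : R ≤ a * (M + 1)) :
    ‖(a : ℂ) * ∑ i ∈ Finset.range M, k (a * (i + 1)) - ∫ s in (0 : ℝ)..R, k s‖ ≤
      a * (3 * M₀ + K₁) := by
  have hkc : Continuous k := hk.continuous
  have hkd : ∀ t, HasDerivAt k (deriv k t) t := fun t ↦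
    ((hk.differentiable one_ne_zero) t).hasDerivAt
  have hk'c : Continuous (deriv k) := hk.continuous_deriv le_rfl
  set T₂ : ℝ := a * (M + 1) with hT₂
  have hT₂0 : 0 ≤ T₂ := by positivity
  have h := Literature.Analysis.Quadrature.norm_smul_sum_range_sub_integral_le
    (F := k) (F' := deriv k) (T₁ := 0) (T₂ := T₂) (Δ := a) (c := a) (M₀ := M₀) (N := M) ha
    ha.le (by simp) (by rw [hT₂]; apply le_of_eq; ring) (by rw [hT₂]; nlinarith)
    hkc.continuousOn (fun t _ ↦ (hkd t).hasDerivWithinAt) (hk'c.intervalIntegrable _ _)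
    (fun t _ ↦ hM₀ t)
  -- the last node vanishes
  have hlast : k (a + M * a) = 0 := hkR _ (by nlinarith)
  have hsum : a • ∑ i ∈ Finset.range (M + 1), k (a + i * a) =
      (a : ℂ) * ∑ i ∈ Finset.range M, k (a * (i + 1)) := by
    rw [Finset.sum_range_succ, hlast, add_zero, Complex.real_smul]
    congr 1
    refine Finset.sum_congr rfl fun i _ ↦ ?_
    congr 1; ring
  -- the integral over `[R, T₂]` vanishes
  have hRT : R ≤ T₂ := hM
  have hint : ∫ s in (0 : ℝ)..T₂, k s = ∫ s in (0 : ℝ)..R, k s := by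
    rw [← integral_add_adjacent_intervals (hkc.intervalIntegrable 0 R)
      (hkc.intervalIntegrable R T₂)]
    have h0 : ∫ s in R..T₂, k s = 0 := by
      rw [integral_congr (g := fun _ ↦ (0 : ℂ)) fun s hs ↦ ?_]
      · simp
      · rw [uIcc_of_le hRT] at hs
        exact hkR s hs.1
    rw [h0, add_zero]
  rw [hsum, hint] at h
  refine h.trans ?_
  have hM0 : 0 ≤ M₀ := (norm_nonneg _).trans (hM₀ 0)
  gcongr
  exact hK₁ T₂ hT₂0

/-! ### The smooth totient sum for `C¹` test functions -/

/-- Harmonic bound in the form used below: `Σ_{1 ≤ d ≤ D} 1/d ≤ 1 + log D`.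
[cite: Apostol1976, Thm 3.2(a) p. 55] -/
theorem sum_Ioc_one_div_le (D : ℕ) :
    ∑ d ∈ Finset.Ioc 0 D, (1 : ℝ) / d ≤ 1 + Real.log D := by
  have h := harmonic_le_one_add_log D
  rw [harmonic_eq_sum_Icc] at h
  push_cast at h
  rw [show Finset.Ioc 0 D = Finset.Icc 1 D by
    ext; simp only [Finset.mem_Ioc, Finset.mem_Icc]; omega]
  simpa [one_div] using h

/-- **Smooth totient sums, `C¹` version.** Let `k : ℝ → ℂ` be `C¹` with compact support and
`k = 0` on `[R, ∞)`, `R > 0`. There is `C` such that for all `0 < l ≤ R` and all `N ≥ R/l`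
`‖Σ_{1 ≤ c ≤ N} (φ(c)/c) k(l c) − (Σ_d μ(d)/d²) (∫₀^R k) / l‖ ≤ C (1 + log(R/l))`
(Möbius inversion, Riemann sums row by row, `Σ_{d ≤ R/l} 1/d ≤ 1 + log(R/l)`,
`Σ_{d > D} d⁻² ≤ 2/(D+1)`). This is Mertens' theorem for `Σ φ(n)` in smoothed form, the step
of Verjovsky's proof of Theorem A. [cite: Verjovsky1994, Thm A p. 597 (proof via Mertens' theorem)] -/
theorem sum_totient_smooth_C1_bound {k : ℝ → ℂ} (hk : ContDiff ℝ 1 k)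
    (hkcs : HasCompactSupport k) {R : ℝ} (hR : 0 < R) (hkR : ∀ s, R ≤ s → k s = 0) :
    ∃ C : ℝ, 0 ≤ C ∧ ∀ l : ℝ, 0 < l → l ≤ R → ∀ N : ℕ, R ≤ l * N →
      ‖∑ c ∈ Finset.Ioc 0 N, ((Nat.totient c : ℂ) / c) * k (l * c) -
        (∑' d : ℕ, (μ d : ℂ) / (d : ℂ) ^ 2) * (∫ s in (0 : ℝ)..R, k s) / l‖ ≤
        C * (1 + Real.log (R / l)) := by
  -- the constants of the row estimate
  obtain ⟨M₀, hM₀⟩ := hk.continuous.bounded_above_of_compact_support hkcs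
  have hk'c : Continuous (deriv k) := hk.continuous_deriv le_rfl
  have hk'i : Integrable (fun s ↦ ‖deriv k s‖) :=
    (hk'c.norm).integrable_of_hasCompactSupport hkcs.deriv.norm
  set K₁ : ℝ := ∫ s, ‖deriv k s‖ with hK₁def
  have hK₁ : ∀ T, 0 ≤ T → ∫ s in (0 : ℝ)..T, ‖deriv k s‖ ≤ K₁ := by
    intro T hT
    rw [intervalIntegral.integral_of_le hT]
    exact setIntegral_le_integral hk'i (Eventually.of_forall fun _ ↦ norm_nonneg _)
  have hM00 : 0 ≤ M₀ := (norm_nonneg _).trans (hM₀ 0)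
  have hK₁0 : 0 ≤ K₁ := integral_nonneg fun _ ↦ norm_nonneg _
  set Ck : ℝ := 3 * M₀ + K₁ with hCk
  have hCk0 : 0 ≤ Ck := by positivity
  set I : ℂ := ∫ s in (0 : ℝ)..R, k s with hI
  set S : ℂ := ∑' d : ℕ, (μ d : ℂ) / (d : ℂ) ^ 2 with hS
  refine ⟨Ck + 2 * ‖I‖ / R, by positivity, fun l hl hlR N hN ↦ ?_⟩
  have hlog0 : 0 ≤ Real.log (R / l) := Real.log_nonneg ((one_le_div hl).2 hlR)
  -- Möbius rearrangement
  rw [HorocycleZeroMode.sum_totient_div_mul_eq]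
  -- rows beyond `D` vanish
  set D₀ : ℕ := ⌊R / l⌋₊ with hD₀
  set D : ℕ := min N D₀ with hD
  have hDN : D ≤ N := min_le_left _ _
  have hDl : (D : ℝ) ≤ R / l := by
    have h1 : (D : ℝ) ≤ D₀ := by exact_mod_cast min_le_right _ _
    exact h1.trans (Nat.floor_le (by positivity))
  have hDl' : R < (D + 1 : ℝ) * l := by
    rcases le_or_gt N D₀ with h | h
    · have : D = N := min_eq_left h
      rw [this]
      nlinarith
    · have : D = D₀ := min_eq_right h.le
      rw [this, hD₀]
      calc R = (R / l) * l := by field_simp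
        _ < (⌊R / l⌋₊ + 1 : ℝ) * l := by gcongr; exact Nat.lt_floor_add_one _
  set row : ℕ → ℂ := fun d ↦ ∑ m ∈ Finset.Ioc 0 (N / d), k (l * (d * m : ℕ)) with hrow
  have hvan : ∀ d ∈ Finset.Ioc 0 N, d ∉ Finset.Ioc 0 D → ((μ d : ℂ) / d) * row d = 0 := by
    intro d hd hdD
    rw [Finset.mem_Ioc] at hd hdD
    have hDd : D < d := by
      by_contra h; exact hdD ⟨hd.1, not_lt.mp h⟩
    have hd' : D₀ < d := by
      rcases le_or_gt N D₀ with h | h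
      · exact absurd (lt_of_lt_of_le (min_eq_left h ▸ hDd) hd.2) (lt_irrefl _)
      · rwa [show D = D₀ from min_eq_right h.le] at hDd
    have hld : R < l * d := by
      have h1 : R / l < d := by
        calc R / l < (⌊R / l⌋₊ : ℝ) + 1 := Nat.lt_floor_add_one _
          _ ≤ d := by exact_mod_cast hd'
      rwa [div_lt_iff₀ hl, mul_comm] at h1
    have : row d = 0 := by
      refine Finset.sum_eq_zero fun m hm ↦ hkR _ ?_
      rw [Finset.mem_Ioc] at hm
      have : (d : ℝ) ≤ (d * m : ℕ) := by exact_mod_cast Nat.le_mul_of_pos_right d hm.1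
      nlinarith
    rw [this, mul_zero]
  rw [← Finset.sum_subset (Finset.Ioc_subset_Ioc_right hDN) hvan]
  -- each remaining row is a Riemann sum with step `l d`
  have hrowE : ∀ d ∈ Finset.Ioc 0 D, ‖row d - I / (l * d)‖ ≤ Ck := by
    intro d hd
    rw [Finset.mem_Ioc] at hd
    have hd0 : 0 < d := hd.1
    have ha : 0 < l * d := by positivity
    have hMd : R ≤ (l * d) * ((N / d : ℕ) + 1) := by
      have h1 : (N : ℝ) < (N / d + 1 : ℕ) * d := by
        exact_mod_cast (mul_comm d _ ▸ Nat.lt_mul_div_succ N hd0 : N < (N / d + 1) * d)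
      push_cast at h1
      nlinarith
    have hrow' : row d = ∑ i ∈ Finset.range (N / d), k ((l * d) * (i + 1)) := by
      rw [hrow]; dsimp only
      rw [HorocycleZeroMode.sum_Ioc_zero_eq_sum_range]
      refine Finset.sum_congr rfl fun i _ ↦ ?_
      congr 1; push_cast; ring
    have h := norm_mul_sum_range_sub_integral_le hk hkR hM₀ hK₁ ha hMd
    rw [← hrow', ← hI] at h
    have hlc : (l : ℂ) ≠ 0 := by exact_mod_cast hl.ne'
    have hdc : (d : ℂ) ≠ 0 := by exact_mod_cast hd0.ne'
    have hane : (l : ℂ) * (d : ℂ) ≠ 0 := mul_ne_zero hlc hdc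
    have e : ((l * d : ℝ) : ℂ) * (row d - I / (l * d)) = ((l * d : ℝ) : ℂ) * row d - I := by
      have : ((l * d : ℝ) : ℂ) = (l : ℂ) * (d : ℂ) := by push_cast; ring
      rw [mul_sub, this, mul_div_cancel₀ _ hane]
    rw [← e, norm_mul, Complex.norm_real, Real.norm_of_nonneg ha.le] at h
    exact le_of_mul_le_mul_left h ha
  -- algebra: split off the main term
  have halg : ∑ d ∈ Finset.Ioc 0 D, ((μ d : ℂ) / d) * row d - S * I / l =
      ∑ d ∈ Finset.Ioc 0 D, ((μ d : ℂ) / d) * (row d - I / (l * d)) -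
        (I / l) * (S - ∑ d ∈ Finset.Ioc 0 D, (μ d : ℂ) / (d : ℂ) ^ 2) := by
    have hl' : (l : ℂ) ≠ 0 := by exact_mod_cast hl.ne'
    have e1 : ∀ d ∈ Finset.Ioc 0 D, ((μ d : ℂ) / d) * row d =
        ((μ d : ℂ) / d) * (row d - I / (l * d)) + (I / l) * ((μ d : ℂ) / (d : ℂ) ^ 2) := by
      intro d hd
      have hd0 : (d : ℂ) ≠ 0 := by exact_mod_cast (Finset.mem_Ioc.1 hd).1.ne'
      field_simp
      ring
    rw [Finset.sum_congr rfl e1, Finset.sum_add_distrib, ← Finset.mul_sum]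
    ring
  rw [halg]
  -- the two bounds
  have b1 : ‖∑ d ∈ Finset.Ioc 0 D, ((μ d : ℂ) / d) * (row d - I / (l * d))‖ ≤
      Ck * (1 + Real.log (R / l)) := by
    calc ‖∑ d ∈ Finset.Ioc 0 D, ((μ d : ℂ) / d) * (row d - I / (l * d))‖
        ≤ ∑ d ∈ Finset.Ioc 0 D, ‖((μ d : ℂ) / d) * (row d - I / (l * d))‖ := norm_sum_le _ _
      _ ≤ ∑ d ∈ Finset.Ioc 0 D, (1 / d) * Ck := by
          refine Finset.sum_le_sum fun d hd ↦ ?_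
          have hd0 : 0 < d := (Finset.mem_Ioc.1 hd).1
          rw [norm_mul, norm_div, Complex.norm_intCast, Complex.norm_natCast]
          have hμ : |((μ d : ℤ) : ℝ)| / d ≤ 1 / d := div_le_div_of_nonneg_right
            (by exact_mod_cast ArithmeticFunction.abs_moebius_le_one) (by positivity)
          gcongr
          exact hrowE d hd
      _ = Ck * ∑ d ∈ Finset.Ioc 0 D, (1 : ℝ) / d := by rw [Finset.mul_sum]; simp [mul_comm]
      _ ≤ Ck * (1 + Real.log (R / l)) := by
          gcongr
          refine (sum_Ioc_one_div_le D).trans ?_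
          rcases Nat.eq_zero_or_pos D with hD0 | hDpos
          · rw [hD0]; simp [hlog0]
          · exact add_le_add_right (Real.log_le_log (by exact_mod_cast hDpos) hDl) 1
  have b2 : ‖(I / l) * (S - ∑ d ∈ Finset.Ioc 0 D, (μ d : ℂ) / (d : ℂ) ^ 2)‖ ≤ 2 * ‖I‖ / R := by
    rw [norm_mul, norm_div, Complex.norm_real, Real.norm_of_nonneg hl.le]
    have ht := HorocycleZeroMode.norm_tsum_moebius_div_sq_sub_le D
    have hD1 : (0 : ℝ) < D + 1 := by positivity
    calc ‖I‖ / l * ‖S - ∑ d ∈ Finset.Ioc 0 D, (μ d : ℂ) / (d : ℂ) ^ 2‖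
        ≤ ‖I‖ / l * (2 / (D + 1)) := by gcongr
      _ = 2 * ‖I‖ / (l * (D + 1)) := by field_simp
      _ ≤ 2 * ‖I‖ / R := by
          apply div_le_div_of_nonneg_left (by positivity) hR
          nlinarith
  calc ‖∑ d ∈ Finset.Ioc 0 D, ((μ d : ℂ) / d) * (row d - I / (l * d)) -
        (I / l) * (S - ∑ d ∈ Finset.Ioc 0 D, (μ d : ℂ) / (d : ℂ) ^ 2)‖
      ≤ ‖∑ d ∈ Finset.Ioc 0 D, ((μ d : ℂ) / d) * (row d - I / (l * d))‖ +
        ‖(I / l) * (S - ∑ d ∈ Finset.Ioc 0 D, (μ d : ℂ) / (d : ℂ) ^ 2)‖ := norm_sub_le _ _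
    _ ≤ Ck * (1 + Real.log (R / l)) + 2 * ‖I‖ / R := by linarith
    _ ≤ (Ck + 2 * ‖I‖ / R) * (1 + Real.log (R / l)) := by
        have : 0 ≤ 2 * ‖I‖ / R := by positivity
        nlinarith

/-! ### The value `Σ_d μ(d)/d² = 6/π²` and the two sides of Theorem A -/

/-- `Σ_{d ≥ 1} μ(d)/d² = 1/ζ(2) = 6/π²`. [cite: Apostol1976, §11.5 Example 1 p. 229 (Σ μ(n) n^{-s} = 1/ζ(s)) with ζ(2) = π²/6] -/
theorem tsum_moebius_div_sq : ∑' d : ℕ, (μ d : ℂ) / (d : ℂ) ^ 2 = 6 / (Real.pi : ℂ) ^ 2 := by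
  have hw : 1 < (2 : ℂ).re := by norm_num
  have h := hasSum_moebius_term_inv_riemannZeta hw
  have hterm : ∀ n : ℕ, LSeries.term (fun n ↦ ((ArithmeticFunction.moebius n : ℤ) : ℂ)) 2 n =
      (μ n : ℂ) / (n : ℂ) ^ 2 := by
    intro n
    rcases Nat.eq_zero_or_pos n with rfl | hn
    · simp [LSeries.term]
    · rw [LSeries.term_of_ne_zero hn.ne', Complex.cpow_two]
  simp_rw [hterm] at h
  rw [h.tsum_eq, riemannZeta_two]
  have hπ : (Real.pi : ℂ) ≠ 0 := by exact_mod_cast Real.pi_ne_zero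
  field_simp

/-- `m₀(f) = (Σ_d μ(d)/d²) · ∫₀^R u f(u) du` when `f = 0` on `[R, ∞)`.
[cite: Verjovsky1994, §1 Definition of m₀ (m₀(f) = ζ(2)⁻¹ ∫ u f(u) du)] -/
theorem verjovskyMean_eq {f : ℝ → ℂ} (hf : Continuous f) {R : ℝ} (hR : 0 ≤ R)
    (hfR : ∀ s, R ≤ s → f s = 0) :
    verjovskyMean f = (∑' d : ℕ, (μ d : ℂ) / (d : ℂ) ^ 2) *
      ∫ s in (0 : ℝ)..R, (s : ℂ) * f s := by
  rw [tsum_moebius_div_sq, verjovskyMean]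
  have hk : Continuous fun s : ℝ ↦ (s : ℂ) * f s := Complex.continuous_ofReal.mul hf
  have e1 : (fun u : ℝ ↦ ((6 / Real.pi ^ 2 * u : ℝ) : ℂ) * f u) =
      fun u : ℝ ↦ (6 / (Real.pi : ℂ) ^ 2) * ((u : ℂ) * f u) := by
    funext u; push_cast; ring
  rw [e1, MeasureTheory.integral_const_mul]
  congr 1
  -- `∫_{Ioi 0} = ∫_{0..R} + ∫_{Ioi R}` and the second piece vanishes
  have hzero : ∀ s ∈ Ioi R, (s : ℂ) * f s = 0 := fun s hs ↦ by
    rw [hfR s (le_of_lt hs), mul_zero]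
  have hIoiR : IntegrableOn (fun s : ℝ ↦ (s : ℂ) * f s) (Ioi R) :=
    (integrableOn_congr_fun hzero measurableSet_Ioi).2 integrableOn_zero
  have hIoi0 : IntegrableOn (fun s : ℝ ↦ (s : ℂ) * f s) (Ioi 0) := by
    rw [← Ioc_union_Ioi_eq_Ioi hR]
    exact (hk.integrableOn_Icc.mono_set Ioc_subset_Icc_self).union hIoiR
  rw [← integral_interval_add_Ioi hIoi0 hIoiR, setIntegral_eq_zero_of_forall_eq_zero hzero,
    add_zero]

/-- `m_y(f)` as a finite smooth totient sum: for `y > 0`, `l = √y`, `k(u) = u f(u)` and any `N`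
with `l N ≥ R` (where `f = 0` on `[R, ∞)`), `m_y(f) = l Σ_{1 ≤ c ≤ N} (φ(c)/c) k(l c)`.
[cite: Verjovsky1994, §1 eq. (1) (definition of m_y)] -/
theorem verjovskyMeasure_eq_mul_sum {f : ℝ → ℂ} {R : ℝ} (hfR : ∀ s, R ≤ s → f s = 0)
    {y : ℝ} (hy : 0 < y) {N : ℕ} (hN : R ≤ Real.sqrt y * N) :
    verjovskyMeasure y f = (Real.sqrt y : ℂ) *
      ∑ c ∈ Finset.Ioc 0 N, ((Nat.totient c : ℂ) / c) *
        (((Real.sqrt y * c : ℝ) : ℂ) * f (Real.sqrt y * c)) := by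
  set l : ℝ := Real.sqrt y with hl
  have hl0 : 0 < l := Real.sqrt_pos.2 hy
  have hyl : y = l ^ 2 := by rw [hl, Real.sq_sqrt hy.le]
  set G : ℕ → ℂ := fun c ↦ ((y * (Nat.totient c : ℕ) : ℝ) : ℂ) * f (l * c) with hG
  have hsummand : (fun n : ℕ ↦ ((y * (Nat.totient (n + 1) : ℕ) : ℝ) : ℂ) *
      f (Real.sqrt y * (n + 1))) = fun n ↦ G (n + 1) := by
    funext n
    simp only [hG, Nat.cast_succ, hl]
  rw [verjovskyMeasure, hsummand, tsum_eq_sum (s := Finset.range N) (f := fun n ↦ G (n + 1))]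
  · rw [← HorocycleZeroMode.sum_Ioc_zero_eq_sum_range G N, Finset.mul_sum]
    refine Finset.sum_congr rfl fun c hc ↦ ?_
    have hc0 : (c : ℂ) ≠ 0 := by exact_mod_cast (Finset.mem_Ioc.1 hc).1.ne'
    rw [hG]; dsimp only
    rw [hyl]
    push_cast
    field_simp
  · intro n hn
    rw [Finset.mem_range, not_lt] at hn
    rw [hG]; dsimp only
    rw [hfR _ ?_, mul_zero]
    calc R ≤ l * N := hN
      _ ≤ l * ((n + 1 : ℕ) : ℝ) := by gcongr; exact_mod_cast Nat.le_succ_of_le hn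

end VerjovskyTheoremA

open VerjovskyTheoremA in
/-- **Verjovsky 1994, Theorem A** (RH-FREE), proved: for every `f ∈ C_c¹(ℝ₊ˣ)`,
`m_y(f) = m₀(f) + O(y^{1/2} log y)` as `y → 0⁺`. [cite: Verjovsky1994, Thm A p. 597] -/
theorem Verjovsky1994_thmA_holds : Verjovsky1994_thmA := by
  intro f hf
  obtain ⟨hcd, hcs, -⟩ := hf
  have hfc : Continuous f := hcd.continuous
  -- the support bound `R ≥ 1`
  obtain ⟨r, hr⟩ := (hcs.isCompact.isBounded).subset_closedBall (0 : ℝ)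
  set R : ℝ := max r 0 + 1 with hRdef
  have hR1 : 1 ≤ R := by rw [hRdef]; linarith [le_max_right r 0]
  have hR0 : 0 < R := by linarith
  have hfR : ∀ s, R ≤ s → f s = 0 := by
    intro s hs
    refine image_eq_zero_of_notMem_tsupport fun hmem ↦ ?_
    have h1 := hr hmem
    rw [Metric.mem_closedBall, dist_zero_right, Real.norm_eq_abs] at h1
    have : s ≤ r := (le_abs_self s).trans h1
    linarith [le_max_left r 0]
  -- `k(u) = u f(u)`
  set k : ℝ → ℂ := fun u ↦ (u : ℂ) * f u with hkdef
  have hofReal : ContDiff ℝ 1 (fun u : ℝ ↦ (u : ℂ)) := Complex.ofRealCLM.contDiff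
  have hk : ContDiff ℝ 1 k := hofReal.mul hcd
  have hkcs : HasCompactSupport k := hcs.mul_left
  have hkR : ∀ s, R ≤ s → k s = 0 := fun s hs ↦ by
    simp only [hkdef, hfR s hs, mul_zero]
  obtain ⟨C, hC0, hC⟩ := sum_totient_smooth_C1_bound hk hkcs hR0 hkR
  set I : ℂ := ∫ s in (0 : ℝ)..R, k s with hI
  set S : ℂ := ∑' d : ℕ, (μ d : ℂ) / (d : ℂ) ^ 2 with hS
  have hmean : verjovskyMean f = S * I := verjovskyMean_eq hfc hR0.le hfR
  -- the `O`-constant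
  refine isBigO_iff.2 ⟨C * (3 / 2 + |Real.log R|), ?_⟩
  filter_upwards [Ioo_mem_nhdsGT (Real.exp_pos (-1))] with y hy
  obtain ⟨hy0, hy1⟩ := hy
  have hy1' : y < 1 := hy1.trans_le (by
    have := Real.exp_le_one_iff.2 (show (-1 : ℝ) ≤ 0 by norm_num); exact this)
  set l : ℝ := Real.sqrt y with hl
  have hl0 : 0 < l := Real.sqrt_pos.2 hy0
  have hl1 : l < 1 := by
    have h := Real.sqrt_lt_sqrt hy0.le hy1'
    rwa [Real.sqrt_one] at h
  have hlR : l ≤ R := by linarith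
  -- `N` capturing the support
  set N : ℕ := ⌈R / l⌉₊ with hN
  have hNR : R ≤ l * N := by
    have : R / l ≤ N := Nat.le_ceil _
    rwa [div_le_iff₀' hl0] at this
  have hmeas := verjovskyMeasure_eq_mul_sum hfR hy0 hNR
  have hcore := hC l hl0 hlR N hNR
  -- `m_y(f) - m₀(f) = l · (Σ - S I / l)`
  have hlc : (l : ℂ) ≠ 0 := by exact_mod_cast hl0.ne'
  have hdiff : verjovskyMeasure y f - verjovskyMean f =
      (l : ℂ) * (∑ c ∈ Finset.Ioc 0 N, ((Nat.totient c : ℂ) / c) * k (l * c) - S * I / l) := by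
    rw [hmeas, hmean, mul_sub, mul_div_cancel₀ _ hlc]
  rw [hdiff, norm_mul, Complex.norm_real, Real.norm_of_nonneg hl0.le]
  -- the logarithms
  have hlogy : Real.log y < -1 := by
    have := Real.log_lt_log hy0 hy1
    rwa [Real.log_exp] at this
  have hlogl : Real.log l = Real.log y / 2 := by rw [hl, Real.log_sqrt hy0.le]
  have hlogRl : Real.log (R / l) = Real.log R - Real.log y / 2 := by
    rw [Real.log_div hR0.ne' hl0.ne', hlogl]
  have hnorm : ‖y ^ (1 / 2 : ℝ) * Real.log y‖ = l * (-Real.log y) := by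
    rw [norm_mul, Real.norm_of_nonneg (Real.rpow_nonneg hy0.le _), Real.norm_eq_abs,
      abs_of_neg (by linarith), hl, Real.sqrt_eq_rpow]
  rw [hnorm]
  have hkey : 1 + Real.log (R / l) ≤ (3 / 2 + |Real.log R|) * (-Real.log y) := by
    rw [hlogRl]
    have h1 : Real.log R ≤ |Real.log R| := le_abs_self _
    have h2 : 0 ≤ |Real.log R| := abs_nonneg _
    nlinarith
  calc l * ‖∑ c ∈ Finset.Ioc 0 N, ((Nat.totient c : ℂ) / c) * k (l * c) - S * I / l‖
      ≤ l * (C * (1 + Real.log (R / l))) := by gcongr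
    _ ≤ l * (C * ((3 / 2 + |Real.log R|) * (-Real.log y))) := by gcongr
    _ = C * (3 / 2 + |Real.log R|) * (l * (-Real.log y)) := by ring

end Literature.NumberTheory.LFunctions
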